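import Summits.QuantumFields.YangMills.Theorems.BalabanUVNodesPortZDFormatSplit
import Summits.QuantumFields.YangMills.Theorems.BalabanUVNodesPortZDStepRows
import Summits.QuantumFields.YangMills.Theorems.BalabanUVNodesPortZDFirstLevel
import Summits.QuantumFields.YangMills.Theorems.BalabanUVNodesK0RecordFormatNamesLemmas4
import Summits.QuantumFields.YangMills.Theorems.BalabanUVNodesPortS1Frame

/-!
# NODE O port, row PT-A′ (PTZ-1, gen 2): the (L) DIFFERENCE FUNCTIONAL OF RECORD IS THE HISTORY CHANNEL BY NAME, and the history-channel clause of
# `PortZeroInputSplitZD` (stmt 26648, signed v4Ax-LR4 2e9a851246ef134f) AT THE FIRST LEVEL `k = 0` — germ-conditional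

[Balaban1987RG1] = [I] (CMP 109, 1987): (0.17) p. 255, (0.21) p. 256, (1.6) p. 261, (1.18)–(1.19) p. 263, (1.20) p. 264, (2.3) p. 265, (2.12)–(2.13) p. 268;
[Balaban1988RG2Cluster] = [II] (CMP 116, 1988) p. 21 (the two-term bookkeeping `½E₀ + O(1)C₃ε₁ ≤ E₀`).

Seat `ymgap-nodeO-port-PTZ-1` g2 (prover, HELPER MODE; this file `--supports stmt-QuantumFields-26648 --as helper` — port-lead «SLOT RE-KEYED PT-A′ 26648 … helpers
open to all hands», HOME STATUS 2026-08-31T01:00:34Z ∕ LEDGER v5.7; NO `--workitem`: the close of 26648 is CONTENT-gated, (Z) = Thm 3's step at zero input, (L) =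
[II] Lemma 3).  RECORD INSTANCES over the [Ax-4] names (`K0RecordFormatNamesAx`: `recordΦfAx`, `recordΦzAx`, `recordZeroTermsAx`; DEF-1 ed. 11 ✓) of gen 0's generic
rows (`…PortZDStepRows` ✓p797663, `…PortZDFormatSplit` ✓p797676) and of gen 2's first-level file (`…PortZDFirstLevel`).

WHAT IS PROVED (0 sorry; no `def`, no `instance`, no `notation`):
* §1 (every level `k`): `recordΦzAx_eq_stepOutT` ∕ `recordΦfAx_eq_stepOutT` — the two functionals the signed text reads ARE the tree's ONE step functional
  `ZeroInput.stepOutT` at the inputs `A⁰_k` (print's main term) resp. `A_k`, composed with the chart `W_B = unitField θ k K B` (definitional); ★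
  `recordΦfAx_sub_recordΦzAx` — THE (L) SLOT `Φf − Φz` IS THE HISTORY CHANNEL `𝓓_{k+1} = 𝓝_{k+1} − 𝓝⁰_{k+1}` through the chart, BY NAME (so every generic
  row about `mergedTermT − zeroInputMergedTermT` — `ZeroInput.dChannel_eq`, `PortZD.stepOutT_add_sub`, `PortZD.dChannel_gaugeAct(_on)` — is a row about the
  signed slot); `recordΦzAx_eq_of_isBackground` — the (Z) functional under [15] Thm 1's RESTRICTION clause at the charted field: `𝓝⁰_{k+1}(W_B) = 𝐓_k(A⁰_k)(W_B) +
  (1∕g_k²)A(U_{k+1}W_B)` = (2.12)'s outside line at zero input (`PortZD.zeroInputMergedTermT_eq_of_isBackground` instantiated).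
* §2 (`k = 0`): ★★ `formatPlusG_channel_zero_of_germ` — IF the difference functional VANISHES NEAR `B = 0` at level 0 (the GERM hypothesis
  `∀ n, ∀ᶠ B in 𝓝 0, recordΦfAx 0 v (K₀+n) B = recordΦzAx 0 v (K₀+n) B`), THEN it has EVERY format `E ≥ 0` in the signed `FormatPlusG` vehicle at the record
  slots (domains `recordDomSys`, spaces `recordUc … 0 α₀ α₁`, action `recordAct`, rooted embedding `recordEmbJ`, two-volume data `…Ctr`) with the ZERO pieces —
  `PortZDSplit.formatPlusG_of_eventually_zero` + the pieces-free half of (1.19) at the record `BalabanUVNodesPortS1.recordUc_mapsTo_recordAct`; ★★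
  `portZD_histChannel_at_zero_of_germ` — literally the `k = 0` INSTANCE OF THE SIGNED (L) CLAUSE (binders `∀ g, RGEqH 0 β g → InInterval γ₀ 0 g → ∀ E, 0 < E →
  E ≤ Ē → (∀ k₁ < 0, …) → FormatPlusG … (ρ·E) κ`, history `prefixOf g 0`, families `n ↦ recordK₀ F Mc 0 + n`) from the germ hypothesis and `0 ≤ ρ`; ★
  `formatPlusG_recordΦfAx_zero_iff_of_germ` — under the same germ, (Z) at `k = 0` ⟺ the WALL's format of `recordΦfAx` at `k = 0` with the SAME constant
  (`PortZDSplit.formatPlusG_congr` both ways): at the first level the zero-input format IS the format.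
* §3 WHAT DISCHARGES THE GERM (said precisely, proved generically): `recordGerm_zero_of_supp` — the germ (indeed GLOBAL equality) follows from «the record's
  level-0 cut-off is supported in `bgReg_0(a₀)`» by `PortZD.mergedTermFamilyMatT_zero_eq_of_supp` (FILE 7; `θfill.εbg = a₀`, `0 < a₀`).  LOCATED, NOT CLAIMED:
  for the record's PRINTED (2.9) species `chiβOfRecord₁₃Ax = chiFixed29Ax θ.ν θ.ε₂₉` (the `b₀(c)`-variables unrestricted, [I] p. 266) that global support
  hypothesis is NOT expected to be realisable — print restricts the `b₀(c)`-variables through the averaging constraint ON THE FIBRE (rider p. 266–267; tree: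
  hypothesis `hb0` of `Node00.mem_domAltOfRecord_of_chiFix29_eq_one`, `bgReg_0` edition `PortZD.mem_bgReg_zero_of_chiFix29Ax_eq_one`), and the record's transport
  `TβOfRecord₁₃ = TcanOfRecord` reads its density almost everywhere along the fibres and pointwise only on `regSetOfRecord` (`Node00/CanonicalTransportOfRecord`);
  so the discharge of the germ AT THE RECORD = (rider on the fibres over a neighbourhood of `W = 1`) + (transport determinacy there) — outside this helper's
  lane, reported on the cell bus.  For the ALL-BONDS twin `chiFix29AllAxOfRecord` the support hypothesis holds outright (`PortZD.supp_chiFix29AllAx_zero_subset_bgReg`).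

HONEST FRAMING.  Definition chasing + the mould-level zero-pieces lemma; NOTHING of Bałaban's estimates — neither (Z) nor (L) at any `k ≥ 1`, nor the germ at
`k = 0` for the record's printed cut-off — is asserted, ported or discharged; 26648 ∕ 27930⁸ SIGNED·OPEN (content-gated), 27931 under CLOSE HOLD until ⁷‴,
27932 CLOSED; K0⁷ ∕ K-Ax OPEN; counts unmoved; finite 𝕋⁴ at fixed ε — NOT continuum ∕ OS ∕ Clay; the Yang–Mills mass gap is NOT proved by any of this.
-/

noncomputable section

namespace Summit.QuantumFields.YangMills.Theorems.PortZDRecord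

open scoped Topology
open Filter
open Literature.MathematicalPhysics.QuantumFieldTheory.Balaban1983to89
open Literature.MathematicalPhysics.QuantumFieldTheory.Balaban1983to89.Node00
open Literature.MathematicalPhysics.QuantumFieldTheory.Balaban1983to89.T4Continuum (T4Family)
open Literature.MathematicalPhysics.QuantumFieldTheory.Balaban1983to89.B12FormatPlus (FormatPlusG)
open Summit.QuantumFields.YangMills.Theorems.K0RecordFormatNames
open B12Eq019ActionBody (nextAction)

variable (F : T4Family) (a₀ ε₂₉ : ℝ)

/-! ## §1. Every level: the signed functionals are the step functional at `A⁰_k` ∕ `A_k` through the chart; `Φf − Φz` is the history channel -/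

/-- **`Φz` IS THE STEP FUNCTIONAL AT ZERO INPUT through the chart** (definitional): `recordΦzAx k v K B = 𝓝⁰_{k+1}(W_B) = R_k(A⁰_k)(W_B)` with
`W_B = unitField θfill k K B`, the transport ∕ cut-off ∕ radius of record `TβOfRecord₁₃ ∕ chiβOfRecord₁₃Ax θfill ∕ θfill.εbg` and the clamped history `extd v`.
[cite: Balaban1987RG1, (1.6) p.261, (1.20) p.264 (bookkeeping)] -/
theorem recordΦzAx_eq_stepOutT (k : ℕ) (v : Fin (k + 1) → ℝ) (K : ℕ) (B : recordW F a₀ ε₂₉ k K) :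
    recordΦzAx F a₀ ε₂₉ k v K B =
      ((ZeroInput.stepOutT F 2 (TβOfRecord₁₃ F 2) (chiβOfRecord₁₃Ax F 2 (thetaFill F a₀ ε₂₉)) (thetaFill F a₀ ε₂₉).εbg K (T4FlagMemory.extd v) k
          (ZeroInput.mainTermT F 2 (thetaFill F a₀ ε₂₉).εbg K (T4FlagMemory.extd v) k) (unitField F (thetaFill F a₀ ε₂₉) k K B) : ℝ) : ℂ) := rfl

/-- **`Φf` IS THE STEP FUNCTIONAL AT THE FULL INPUT `A_k` through the chart** (definitional): `recordΦfAx k v K B = 𝓝_{k+1}(W_B) = R_k(A_k)(W_B)`.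
[cite: Balaban1987RG1, (1.6) p.261, (1.20) p.264 (bookkeeping)] -/
theorem recordΦfAx_eq_stepOutT (k : ℕ) (v : Fin (k + 1) → ℝ) (K : ℕ) (B : recordW F a₀ ε₂₉ k K) :
    recordΦfAx F a₀ ε₂₉ k v K B =
      ((ZeroInput.stepOutT F 2 (TβOfRecord₁₃ F 2) (chiβOfRecord₁₃Ax F 2 (thetaFill F a₀ ε₂₉)) (thetaFill F a₀ ε₂₉).εbg K (T4FlagMemory.extd v) k
          (effActionHT F 2 (TβOfRecord₁₃ F 2) (chiβOfRecord₁₃Ax F 2 (thetaFill F a₀ ε₂₉)) K (T4FlagMemory.extd v) k)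
          (unitField F (thetaFill F a₀ ε₂₉) k K B) : ℝ) : ℂ) := rfl

/-- ★ **THE (L) SLOT `Φf − Φz` IS THE HISTORY CHANNEL BY NAME**: `recordΦfAx k v K B − recordΦzAx k v K B = 𝓓_{k+1}(W_B) := 𝓝_{k+1}(W_B) − 𝓝⁰_{k+1}(W_B)`
(`Node00.mergedTermT − ZeroInput.zeroInputMergedTermT` at the record's transport, cut-off, radius, the clamped history and the charted field), cast to `ℂ`.
[cite: Balaban1987RG1, (1.6) p.261; Balaban1988RG2Cluster, p.21 (bookkeeping)] -/
theorem recordΦfAx_sub_recordΦzAx (k : ℕ) (v : Fin (k + 1) → ℝ) (K : ℕ) (B : recordW F a₀ ε₂₉ k K) :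
    recordΦfAx F a₀ ε₂₉ k v K B - recordΦzAx F a₀ ε₂₉ k v K B =
      ((mergedTermT F 2 (TβOfRecord₁₃ F 2) (chiβOfRecord₁₃Ax F 2 (thetaFill F a₀ ε₂₉)) (thetaFill F a₀ ε₂₉).εbg K (T4FlagMemory.extd v) k
            (unitField F (thetaFill F a₀ ε₂₉) k K B) -
          ZeroInput.zeroInputMergedTermT F 2 (TβOfRecord₁₃ F 2) (chiβOfRecord₁₃Ax F 2 (thetaFill F a₀ ε₂₉)) (thetaFill F a₀ ε₂₉).εbg K
            (T4FlagMemory.extd v) k (unitField F (thetaFill F a₀ ε₂₉) k K B) : ℝ) : ℂ) := by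
  rw [Complex.ofReal_sub]
  rfl

/-- The same one unfolding up: the slot is the difference of the two matrix-carrier FAMILIES at the exponentiated field (the species `PortZD.mergedTermFamilyMatT_sub_zeroInput`
and `PortZD.mergedTermFamilyMatT_zero_eq_of_supp` speak about). [cite: Balaban1987RG1, (1.20) p.264 (bookkeeping)] -/
theorem recordΦfAx_sub_recordΦzAx_eq_family (k : ℕ) (v : Fin (k + 1) → ℝ) (K : ℕ) (B : recordW F a₀ ε₂₉ k K) :
    recordΦfAx F a₀ ε₂₉ k v K B - recordΦzAx F a₀ ε₂₉ k v K B =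
      (letI θ := thetaFill F a₀ ε₂₉
       letI := θ.instVβ₁; letI := θ.instVβ₂
       ((mergedTermFamilyMatT F 2 (TβOfRecord₁₃ F 2) (chiβOfRecord₁₃Ax F 2 θ) θ.εbg k v K (fun μ x => NormedSpace.exp (θ.ρ8 (B μ x))) -
           ZeroInput.zeroInputMergedTermFamilyMatT F 2 (TβOfRecord₁₃ F 2) (chiβOfRecord₁₃Ax F 2 θ) θ.εbg k v K
             (fun μ x => NormedSpace.exp (θ.ρ8 (B μ x))) : ℝ) : ℂ)) := by
  rw [Complex.ofReal_sub]
  rfl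

/-- **THE (Z) FUNCTIONAL UNDER [15] Thm 1's RESTRICTION CLAUSE** at the charted field `W_B` — «`U_{k+1}(W_B)` is a level-`k` minimiser over its own `k`-average»
((2.3) `V^{(k)} = M_k(U_{k+1})`, a displayed hypothesis `hR`): `recordΦzAx k v K B = 𝐓_k(A⁰_k)(W_B) + (1∕g_k²)·A(U_{k+1}(W_B))` — (2.12)'s outside line at zero input,
i.e. the zero-input new term «E^{(k+1)}(g_k, U_{k+1})» of (2.13). [cite: Balaban1987RG1, (2.3) p.265, (2.12)–(2.13) p.268; Balaban1985Variational, Thm 1 p.279] -/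
theorem recordΦzAx_eq_of_isBackground (k : ℕ) (v : Fin (k + 1) → ℝ) (K : ℕ) (B : recordW F a₀ ε₂₉ k K)
    (hR : IsBackground (avOfRecord F 2 K) (bgReg F 2 K k (thetaFill F a₀ ε₂₉).εbg) k
      (Averaging.iter (avOfRecord F 2 K) k (Uk F 2 K (k + 1) (thetaFill F a₀ ε₂₉).εbg (unitField F (thetaFill F a₀ ε₂₉) k K B)))
      (Uk F 2 K (k + 1) (thetaFill F a₀ ε₂₉).εbg (unitField F (thetaFill F a₀ ε₂₉) k K B))) :
    recordΦzAx F a₀ ε₂₉ k v K B =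
      ((nextAction (TβOfRecord₁₃ F 2 K k) (chiβOfRecord₁₃Ax F 2 (thetaFill F a₀ ε₂₉) K (T4FlagMemory.extd v) k) (gfOfRecord F 2 K k)
            (T4FlagMemory.extd v k) (ZeroInput.mainTermT F 2 (thetaFill F a₀ ε₂₉).εbg K (T4FlagMemory.extd v) k)
            (unitField F (thetaFill F a₀ ε₂₉) k K B) +
          1 / (T4FlagMemory.extd v k) ^ 2 * wilsonAction4 (Uk F 2 K (k + 1) (thetaFill F a₀ ε₂₉).εbg (unitField F (thetaFill F a₀ ε₂₉) k K B)) : ℝ) : ℂ) := by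
  rw [← PortZD.zeroInputMergedTermT_eq_of_isBackground F 2 (TβOfRecord₁₃ F 2) (chiβOfRecord₁₃Ax F 2 (thetaFill F a₀ ε₂₉)) _ K _ k _ hR]
  rfl

/-! ## §2. The first level `k = 0`: the history-channel clause of the signed text from the germ hypothesis -/

/-- ★★ **A DIFFERENCE FUNCTIONAL VANISHING NEAR `B = 0` AT LEVEL 0 HAS EVERY FORMAT `E ≥ 0` AT THE RECORD SLOTS, WITH THE ZERO PIECES** — the shifted
family `n ↦ K₀ + n` of the signed text, the record's domains ∕ bond counts ∕ action ∕ spaces ∕ coordinates ∕ chart ∕ rooted embedding ∕ two-volume data, ANY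
history `v`, decay rate `κ`, constant `0 ≤ E`: from the GERM hypothesis at level 0 (print: no history at the first step, (0.17)); the (1.10) action preserves the
spaces by `BalabanUVNodesPortS1.recordUc_mapsTo_recordAct`. [cite: Balaban1987RG1, (0.17) p.255, (1.18)–(1.19) p.263; Balaban1988RG2Cluster, p.21] -/
theorem formatPlusG_channel_zero_of_germ (Mc K₀ : ℕ) (α₀ α₁ κ E : ℝ) (hE : 0 ≤ E) (v : Fin 1 → ℝ)
    (hgerm : letI θ := thetaFill F a₀ ε₂₉
      letI := θ.instVβ₁; letI := θ.instVβ₂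
      ∀ n, ∀ᶠ B in 𝓝 (0 : recordW F a₀ ε₂₉ 0 (K₀ + n)), recordΦfAx F a₀ ε₂₉ 0 v (K₀ + n) B = recordΦzAx F a₀ ε₂₉ 0 v (K₀ + n) B) :
    letI θ := thetaFill F a₀ ε₂₉
    letI := θ.instVβ₁; letI := θ.instVβ₂; letI := θ.instιβ
    FormatPlusG (fun n => recordDomSys F Mc 0 (K₀ + n)) (fun n => recordBondCount F (K₀ + n)) (fun n => recordAct F (K₀ + n))
      (fun n => recordUc F Mc 0 α₀ α₁ (K₀ + n)) (fun n => recordCoords F Mc 0 (K₀ + n)) (fun n => recordChartDimJ F (K₀ + n))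
      (fun n => recordChartJ F Mc 0 (K₀ + n))
      (fun n B => recordΦfAx F a₀ ε₂₉ 0 v (K₀ + n) B - recordΦzAx F a₀ ε₂₉ 0 v (K₀ + n) B)
      (fun n => recordEmbJ F θ 0 (K₀ + n)) (fun n => recordWrapCtr F Mc 0 (K₀ + n)) (fun n => recordDomEmbCtr F Mc 0 (K₀ + n))
      (fun n _ => recordCoordProjCtr F (K₀ + n)) E κ := by
  letI θ := thetaFill F a₀ ε₂₉
  letI := θ.instVβ₁; letI := θ.instVβ₂; letI := θ.instιβ
  refine PortZDSplit.formatPlusG_of_eventually_zero (BalabanUVNodesPortS1.gaugeInv119_spaces_record F Mc 0 α₀ α₁ K₀) (fun n => ?_) hE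
  filter_upwards [hgerm n] with B hB
  rw [hB, sub_self]

/-- ★★ **THE `k = 0` INSTANCE OF THE SIGNED (L) CLAUSE OF `PortZeroInputSplitZD` (26648, v4Ax-LR4 2e9a851246ef134f), FROM THE GERM HYPOTHESIS** — binders and slots
verbatim with `k := 0` (the same-run flow guard `RGEqH 0 β g → InInterval γ₀ 0 g`, the range `0 < E ≤ Ē`, the VACUOUS previous-levels antecedent `∀ k₁ < 0, …`,
history `prefixOf g 0`, families `n ↦ recordK₀ F Mc 0 + n`, constant `ρ·E` with `0 ≤ ρ`); `β`, `γ₀`, `Ē`, `κ`, `α₀`, `α₁` free.  The germ hypothesis is asked at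
every guarded run's prefix. [cite: Balaban1987RG1, (0.17) p.255, (1.18)–(1.19) p.263, (0.20) p.256; Balaban1988RG2Cluster, p.21] -/
theorem portZD_histChannel_at_zero_of_germ (Mc : ℕ) (β : FlowStep.HBeta) (γ₀ ρ Ē κ α₀ α₁ : ℝ) (hρ : 0 ≤ ρ)
    (hgerm : letI θ := thetaFill F a₀ ε₂₉
      letI := θ.instVβ₁; letI := θ.instVβ₂
      ∀ g : ℕ → ℝ, FlowStep.RGEqH 0 β g → Step.InInterval γ₀ 0 g →
        ∀ n, ∀ᶠ B in 𝓝 (0 : recordW F a₀ ε₂₉ 0 (recordK₀ F Mc 0 + n)),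
          recordΦfAx F a₀ ε₂₉ 0 (FlowStep.prefixOf g 0) (recordK₀ F Mc 0 + n) B = recordΦzAx F a₀ ε₂₉ 0 (FlowStep.prefixOf g 0) (recordK₀ F Mc 0 + n) B) :
    ∀ g : ℕ → ℝ, FlowStep.RGEqH 0 β g → Step.InInterval γ₀ 0 g → ∀ E : ℝ, 0 < E → E ≤ Ē →
      (∀ k₁ : ℕ, k₁ < 0 →
        letI θ := thetaFill F a₀ ε₂₉
        letI := θ.instVβ₁; letI := θ.instVβ₂; letI := θ.instιβ
        FormatPlusG (fun n => recordDomSys F Mc k₁ (recordK₀ F Mc k₁ + n)) (fun n => recordBondCount F (recordK₀ F Mc k₁ + n))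
          (fun n => recordAct F (recordK₀ F Mc k₁ + n)) (fun n => recordUc F Mc k₁ α₀ α₁ (recordK₀ F Mc k₁ + n))
          (fun n => recordCoords F Mc k₁ (recordK₀ F Mc k₁ + n)) (fun n => recordChartDimJ F (recordK₀ F Mc k₁ + n))
          (fun n => recordChartJ F Mc k₁ (recordK₀ F Mc k₁ + n))
          (fun n => recordΦfAx F a₀ ε₂₉ k₁ (FlowStep.prefixOf g k₁) (recordK₀ F Mc k₁ + n))
          (fun n => recordEmbJ F θ k₁ (recordK₀ F Mc k₁ + n)) (fun n => recordWrapCtr F Mc k₁ (recordK₀ F Mc k₁ + n))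
          (fun n => recordDomEmbCtr F Mc k₁ (recordK₀ F Mc k₁ + n)) (fun n _ => recordCoordProjCtr F (recordK₀ F Mc k₁ + n)) E κ) →
      letI θ := thetaFill F a₀ ε₂₉
      letI := θ.instVβ₁; letI := θ.instVβ₂; letI := θ.instιβ
      FormatPlusG (fun n => recordDomSys F Mc 0 (recordK₀ F Mc 0 + n)) (fun n => recordBondCount F (recordK₀ F Mc 0 + n))
        (fun n => recordAct F (recordK₀ F Mc 0 + n)) (fun n => recordUc F Mc 0 α₀ α₁ (recordK₀ F Mc 0 + n))
        (fun n => recordCoords F Mc 0 (recordK₀ F Mc 0 + n)) (fun n => recordChartDimJ F (recordK₀ F Mc 0 + n))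
        (fun n => recordChartJ F Mc 0 (recordK₀ F Mc 0 + n))
        (fun n B => recordΦfAx F a₀ ε₂₉ 0 (FlowStep.prefixOf g 0) (recordK₀ F Mc 0 + n) B -
          recordΦzAx F a₀ ε₂₉ 0 (FlowStep.prefixOf g 0) (recordK₀ F Mc 0 + n) B)
        (fun n => recordEmbJ F θ 0 (recordK₀ F Mc 0 + n)) (fun n => recordWrapCtr F Mc 0 (recordK₀ F Mc 0 + n))
        (fun n => recordDomEmbCtr F Mc 0 (recordK₀ F Mc 0 + n)) (fun n _ => recordCoordProjCtr F (recordK₀ F Mc 0 + n)) (ρ * E) κ :=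
  fun g hfl hin E hE _ _ =>
    formatPlusG_channel_zero_of_germ F a₀ ε₂₉ Mc (recordK₀ F Mc 0) α₀ α₁ κ (ρ * E) (mul_nonneg hρ hE.le) (FlowStep.prefixOf g 0) (hgerm g hfl hin)

/-- ★ **AT THE FIRST LEVEL THE ZERO-INPUT FORMAT IS THE FORMAT**: under the germ hypothesis at level 0, `recordΦzAx 0 v` has format `(E₀, κ)` at the record slots
IFF `recordΦfAx 0 v` has it — the (Z) clause at `k = 0` and the WALL (27930⁸'s consequent) at `k = 0` carry the SAME constant (the mould reads only the germ at `0`,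
`PortZDSplit.formatPlusG_congr`). [cite: Balaban1987RG1, (1.18) p.263, (0.17) p.255; Balaban1988RG2Cluster, p.21] -/
theorem formatPlusG_recordΦfAx_zero_iff_of_germ (Mc K₀ : ℕ) (α₀ α₁ κ E₀ : ℝ) (v : Fin 1 → ℝ)
    (hgerm : letI θ := thetaFill F a₀ ε₂₉
      letI := θ.instVβ₁; letI := θ.instVβ₂
      ∀ n, ∀ᶠ B in 𝓝 (0 : recordW F a₀ ε₂₉ 0 (K₀ + n)), recordΦfAx F a₀ ε₂₉ 0 v (K₀ + n) B = recordΦzAx F a₀ ε₂₉ 0 v (K₀ + n) B) :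
    letI θ := thetaFill F a₀ ε₂₉
    letI := θ.instVβ₁; letI := θ.instVβ₂; letI := θ.instιβ
    FormatPlusG (fun n => recordDomSys F Mc 0 (K₀ + n)) (fun n => recordBondCount F (K₀ + n)) (fun n => recordAct F (K₀ + n))
        (fun n => recordUc F Mc 0 α₀ α₁ (K₀ + n)) (fun n => recordCoords F Mc 0 (K₀ + n)) (fun n => recordChartDimJ F (K₀ + n))
        (fun n => recordChartJ F Mc 0 (K₀ + n)) (fun n => recordΦfAx F a₀ ε₂₉ 0 v (K₀ + n))
        (fun n => recordEmbJ F θ 0 (K₀ + n)) (fun n => recordWrapCtr F Mc 0 (K₀ + n)) (fun n => recordDomEmbCtr F Mc 0 (K₀ + n))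
        (fun n _ => recordCoordProjCtr F (K₀ + n)) E₀ κ ↔
      FormatPlusG (fun n => recordDomSys F Mc 0 (K₀ + n)) (fun n => recordBondCount F (K₀ + n)) (fun n => recordAct F (K₀ + n))
        (fun n => recordUc F Mc 0 α₀ α₁ (K₀ + n)) (fun n => recordCoords F Mc 0 (K₀ + n)) (fun n => recordChartDimJ F (K₀ + n))
        (fun n => recordChartJ F Mc 0 (K₀ + n)) (fun n => recordΦzAx F a₀ ε₂₉ 0 v (K₀ + n))
        (fun n => recordEmbJ F θ 0 (K₀ + n)) (fun n => recordWrapCtr F Mc 0 (K₀ + n)) (fun n => recordDomEmbCtr F Mc 0 (K₀ + n))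
        (fun n _ => recordCoordProjCtr F (K₀ + n)) E₀ κ := by
  letI θ := thetaFill F a₀ ε₂₉
  letI := θ.instVβ₁; letI := θ.instVβ₂; letI := θ.instιβ
  constructor
  · intro h
    exact PortZDSplit.formatPlusG_congr h fun n => by
      filter_upwards [hgerm n] with B hB
      exact hB.symm
  · intro h
    exact PortZDSplit.formatPlusG_congr h fun n => by
      filter_upwards [hgerm n] with B hB
      exact hB

/-! ## §3. What discharges the germ, generically: a level-0 cut-off supported in the regularity class -/

/-- **THE GERM — indeed GLOBAL equality `Φf = Φz` at level 0 — FROM A REGULAR SUPPORT OF THE LEVEL-0 CUT-OFF OF RECORD** (`θfill.εbg = a₀`, `0 < a₀`;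
`PortZD.mergedTermFamilyMatT_zero_eq_of_supp_flowBlind`, the cut-off being coupling-blind).  SAID, NOT CLAIMED: for the record's PRINTED (2.9) species (the
`b₀(c)`-variables unrestricted) the displayed support hypothesis is NOT expected to be realisable globally — print obtains it ON THE FIBRE from the averaging
constraint (rider p. 266–267), which the record's transport reads almost everywhere; it holds outright for the all-bonds twin (`PortZD.supp_chiFix29AllAx_zero_subset_bgReg`).
[cite: Balaban1987RG1, (0.17) p.255, (0.21) p.256, (2.9) p.266–267 (bookkeeping)] -/
theorem recordΦfAx_zero_eq_recordΦzAx_of_supp (ha₀ : 0 < a₀) (K : ℕ) (g₀ : ℕ → ℝ)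
    (hχ : ∀ V : GaugeField (F.P K) 0 (SU 2), chiβOfRecord₁₃Ax F 2 (thetaFill F a₀ ε₂₉) K g₀ 0 V ≠ 0 → V ∈ bgReg F 2 K 0 a₀)
    (v : Fin 1 → ℝ) (B : recordW F a₀ ε₂₉ 0 K) : recordΦfAx F a₀ ε₂₉ 0 v K B = recordΦzAx F a₀ ε₂₉ 0 v K B := by
  rw [← sub_eq_zero, recordΦfAx_sub_recordΦzAx_eq_family, Complex.ofReal_eq_zero, sub_eq_zero]
  exact PortZD.mergedTermFamilyMatT_zero_eq_of_supp_flowBlind (TβOfRecord₁₃ F 2) (chiβOfRecord₁₃Ax F 2 (thetaFill F a₀ ε₂₉))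
    (chiβOfRecord₁₃Ax_flowBlind (thetaFill F a₀ ε₂₉)) ha₀ K g₀ hχ v _

end Summit.QuantumFields.YangMills.Theorems.PortZDRecord

end
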